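import Mathlib.Geometry.Manifold.Complex
import Literature.Geometry.Kaehler.SurfaceHolomorphicTwoFormRatio
import Literature.Geometry.Kaehler.HolomorphicFormsInCharts
import HarnessLib

/-!
# Holomorphic top forms on a compact connected complex manifold with a nowhere-vanishing one form a line

Family `hodge` / trunk Kähler, layer `Literature/Geometry/Kaehler`. PROOF FILE (theorems only; no
definitions, no named facts — D-0026). Let `M` be a complex manifold charted on the complex normed
space `E` with `dim_ℂ E = n`, and let `η`, `ω₀` be complex `n`-forms holomorphic in charts
(`IsHolomorphicInCharts`, Huybrechts Def. 2.2.14: holomorphic sections of the canonical bundle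
`K_M = Ω^n_M`).

* `mdifferentiableAt_topFormRatio_of_isHolomorphicInCharts` — if `ω₀ x (e) ≠ 0` near `x₀` for a
  complex frame `e`, the quotient `f = η(e)/ω₀(e)` is complex differentiable at `x₀`: in the chart
  at `x₀` both forms are germs of analytic functions with values in the `ℂ`-alternating `n`-forms,
  `η̂ = (f ∘ chart⁻¹) · ω̂₀` (`topForm_eq_ratio_smul`: `Λ^{n,0} E^* = ℂ · det_e`), so `f ∘ chart⁻¹` is
  the quotient of two analytic scalar germs with non-vanishing denominator. (For a CLOSED
  `(n,0)`-form `η` and an analytic `ω₀` this is `mdifferentiableAt_twoFormRatio` of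
  `SurfaceHolomorphicTwoFormRatio` in dimension `2`; here both forms are holomorphic and `n` is
  arbitrary, so no closedness computation is needed.)
* `exists_eq_const_smul_of_isHolomorphicInCharts` — **if `M` is compact and connected and `ω₀`
  vanishes nowhere, every holomorphic `n`-form is a constant multiple of `ω₀`**: the quotient is a
  holomorphic function on a compact connected complex manifold, hence constant (Mathlib's
  `MDifferentiable.exists_eq_const_of_compactSpace`). In print: a nowhere-vanishing holomorphic
  section trivialises `K_M`, so `H⁰(M, K_M) = H⁰(M, 𝒪_M) · ω₀ = ℂ · ω₀` (Griffiths–Harris, Ch. 1 §1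
  "Divisors and line bundles"; Huybrechts, Prop. 2.6.11 — so `h^{n,0} = 1` for a compact connected
  manifold with trivial canonical bundle, e.g. a Calabi–Yau hypersurface).
* `holFormsInCharts_eq_span_singleton` — the same as an equality of `ℂ`-submodules:
  `Ω^n(M) = ℂ ∙ ω₀`.

Consumer: the `Γ`-character of `H^{n,0}` of a Calabi–Yau hypersurface (`Res(Ω/F)` is nowhere zero
and transforms by `det`; `AlgebraicGeometry/HodgeTheory/CalabiYauHypersurfaceTopFormCharacter`).

## References

* [GriffithsHarris1978] P. Griffiths, J. Harris, Principles of Algebraic Geometry (1978), Ch. 0 §2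
  (maximum principle on compact manifolds) and Ch. 1 §1 (divisors and line bundles).
* [Huybrechts2005] D. Huybrechts, Complex Geometry (2005), Def. 2.2.14, Prop. 2.6.11.
* [VoisinHodgeI2002] C. Voisin, Hodge Theory and Complex Algebraic Geometry I (2002), §2.3.1.
-/

noncomputable section

open scoped Manifold ContDiff Topology
open Set Filter Function
open Literature.NumberTheory.Transcendental

namespace Literature.Geometry.Kaehler

variable {E : Type*} [NormedAddCommGroup E] [NormedSpace ℂ E] [FiniteDimensional ℂ E]
  {M : Type*} [TopologicalSpace M] [ChartedSpace E M] [IsManifold 𝓘(ℝ, E) ∞ M] {n : ℕ}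

/-! ### A non-zero `ℂ`-alternating top form does not vanish on a basis -/

omit [FiniteDimensional ℂ E] in
/-- A non-zero continuous `ℂ`-alternating `n`-form on an `n`-dimensional space does not vanish on
any basis (`AlternatingMap.eq_smul_basis_det`: `a = a(b) det_b`; the tree's
`HodgeTheory.apply_ne_zero_of_ne_zero`, repeated privately to keep the import cone inside
`Geometry/Kaehler`). [folklore] -/
private theorem continuousAlternatingMap_apply_basis_ne_zero (a : E [⋀^Fin n]→L[ℂ] ℂ)
    (b : Module.Basis (Fin n) ℂ E) (ha : a ≠ 0) : a b ≠ 0 := by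
  intro h0
  apply ha
  have key := a.toAlternatingMap.eq_smul_basis_det b
  ext v
  have h := congrArg (fun f : E [⋀^Fin n]→ₗ[ℂ] ℂ ↦ f v) key
  simp only [AlternatingMap.smul_apply, smul_eq_mul] at h
  change a v = a b * b.det v at h
  change a v = 0
  rw [h, h0, zero_mul]

omit [FiniteDimensional ℂ E] in
/-- A holomorphic-in-charts `n`-form which is non-zero at `x` (`dim_ℂ E = n`) does not vanish on
any complex basis at `x`: its value is a `ℂ`-alternating top form
(`IsHolomorphicInCharts.exists_apply_eq_restrictScalars`), i.e. a multiple of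
`dz₁ ∧ ⋯ ∧ dz_n = det` (Voisin I, §2.3.1: `Λ^{n,0} E^* = ℂ · dz_I`, `|I| = n`).
[cite: VoisinHodgeI2002, §2.3.1] -/
theorem IsHolomorphicInCharts.apply_basis_ne_zero {ω₀ : MForm 𝓘(ℝ, E) M ℂ n}
    (hω : IsHolomorphicInCharts ω₀) (b : Module.Basis (Fin n) ℂ E) {x : M} (hx : ω₀ x ≠ 0) :
    (ω₀ x : E [⋀^Fin n]→L[ℝ] ℂ) b ≠ 0 := by
  obtain ⟨a, ha⟩ := hω.exists_apply_eq_restrictScalars x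
  have ha0 : a ≠ 0 := by
    rintro rfl
    exact hx (by rw [ha]; ext v; rfl)
  have h := continuousAlternatingMap_apply_basis_ne_zero a b ha0
  rwa [ha]

/-! ### The quotient of two holomorphic top forms is holomorphic -/

/-- **The quotient of two holomorphic top forms is holomorphic.** On a complex manifold `M`
charted on `E` with `dim_ℂ E = n`, let `η`, `ω₀` be `n`-forms holomorphic in charts and `e` a
complex frame of `E` with `ω₀ x (e) ≠ 0` for `x` near `x₀`. Then `f = η(e)/ω₀(e)` is complex
differentiable at `x₀`: in the chart at `x₀`, `η̂ = (f ∘ chart⁻¹) · ω̂₀` (`topForm_eq_ratio_smul`),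
and `η̂`, `ω̂₀` are germs of complex-analytic functions, so `f ∘ chart⁻¹ = η̂(e)/ω̂₀(e)` is analytic
at the centre. In print: the quotient of two holomorphic sections of the canonical line bundle,
the second non-vanishing, is a holomorphic function. [cite: GriffithsHarris1978, Ch. 1 §1 (divisors and line bundles)]
[cite: Huybrechts2005, Def. 2.2.14] -/
theorem mdifferentiableAt_topFormRatio_of_isHolomorphicInCharts (hn : Module.finrank ℂ E = n)
    {η ω₀ : MForm 𝓘(ℝ, E) M ℂ n} (hη : IsHolomorphicInCharts η) (hω : IsHolomorphicInCharts ω₀)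
    {e : Fin n → E} (he : LinearIndependent ℂ e) {x₀ : M}
    (hne : ∀ᶠ x in 𝓝 x₀, (ω₀ x : E [⋀^Fin n]→L[ℝ] ℂ) e ≠ 0) :
    MDifferentiableAt 𝓘(ℂ, E) 𝓘(ℂ, ℂ)
      (fun x ↦ (η x : E [⋀^Fin n]→L[ℝ] ℂ) e / (ω₀ x : E [⋀^Fin n]→L[ℝ] ℂ) e) x₀ := by
  -- the frame as a basis
  have hcard : Fintype.card (Fin n) = Module.finrank ℂ E := by simp [hn]
  set b : Module.Basis (Fin n) ℂ E := basisOfLinearIndependentOfCardEqFinrank' e he hcard with hbdef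
  have hb : (b : Fin n → E) = e := coe_basisOfLinearIndependentOfCardEqFinrank' e he hcard
  set f : M → ℂ := fun x ↦ (η x : E [⋀^Fin n]→L[ℝ] ℂ) e / (ω₀ x : E [⋀^Fin n]→L[ℝ] ℂ) e with hfdef
  set φ := extChartAt 𝓘(ℝ, E) x₀ with hφ
  set y₀ : E := φ x₀ with hy₀
  set F : E → ℂ := f ∘ φ.symm with hF
  have hsymm : φ.symm y₀ = x₀ := extChartAt_to_inv x₀
  have hsymmc : ContinuousAt φ.symm y₀ := continuousAt_extChartAt_symm x₀
  -- (1) `η̂ = F • ω̂₀` near `y₀`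
  have hne' : ∀ᶠ y in 𝓝 y₀, (ω₀ (φ.symm y) : E [⋀^Fin n]→L[ℝ] ℂ) e ≠ 0 := by
    have h : ∀ᶠ x in 𝓝 (φ.symm y₀), (ω₀ x : E [⋀^Fin n]→L[ℝ] ℂ) e ≠ 0 := by rw [hsymm]; exact hne
    exact hsymmc.tendsto.eventually h
  have hAFG : ∀ᶠ y in 𝓝 y₀, η.inChart x₀ y = F y • ω₀.inChart x₀ y := by
    filter_upwards [hne'] with y hy
    obtain ⟨a, ha⟩ := hω.exists_apply_eq_restrictScalars (φ.symm y)
    have hyb : (ω₀ (φ.symm y) : E [⋀^Fin n]→L[ℝ] ℂ) b ≠ 0 := by rw [hb]; exact hy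
    have key := topForm_eq_ratio_smul hη.isOfType b ha hyb
    rw [hb] at key
    simp only [hF, MForm.inChart, Function.comp_apply]
    rw [key]
    ext v
    rfl
  -- (2) the analytic germs
  obtain ⟨gη, hgη, hAg⟩ := hη x₀
  obtain ⟨gω, hgω, hGg⟩ := hω x₀
  change AnalyticAt ℂ gη y₀ at hgη
  change AnalyticAt ℂ gω y₀ at hgω
  change η.inChart x₀ =ᶠ[𝓝 y₀] fun y ↦ (gη y).restrictScalars ℝ at hAg
  change ω₀.inChart x₀ =ᶠ[𝓝 y₀] fun y ↦ (gω y).restrictScalars ℝ at hGg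
  set γ : E → ℂ := fun y ↦ gω y e with hγ
  set α : E → ℂ := fun y ↦ gη y e with hα
  have hγan : AnalyticAt ℂ γ y₀ := ((ContinuousAlternatingMap.apply ℂ E ℂ e).analyticAt _).comp hgω
  have hαan : AnalyticAt ℂ α y₀ := ((ContinuousAlternatingMap.apply ℂ E ℂ e).analyticAt _).comp hgη
  have hγ0 : γ y₀ ≠ 0 := by
    have h1 : (ω₀.inChart x₀ y₀ : E [⋀^Fin n]→L[ℝ] ℂ) e = γ y₀ := by rw [hGg.self_of_nhds]; rfl
    have h2 : ω₀.inChart x₀ y₀ = ω₀ x₀ := MForm.inChart_apply_self ω₀ x₀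
    intro h0
    apply hne.self_of_nhds
    have h3 : (ω₀.inChart x₀ y₀ : E [⋀^Fin n]→L[ℝ] ℂ) e = 0 := h1.trans h0
    rw [h2] at h3
    exact h3
  -- (3) `F = α / γ` near `y₀`
  have hγne : ∀ᶠ y in 𝓝 y₀, γ y ≠ 0 := hγan.continuousAt.eventually_ne hγ0
  have hFeq : F =ᶠ[𝓝 y₀] fun y ↦ α y / γ y := by
    filter_upwards [hAFG, hAg, hGg, hγne] with y hyA hyη hyω hyne
    have h1 : (η.inChart x₀ y : E [⋀^Fin n]→L[ℝ] ℂ) e = F y * (ω₀.inChart x₀ y : E [⋀^Fin n]→L[ℝ] ℂ) e := by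
      rw [hyA, ContinuousAlternatingMap.smul_apply, smul_eq_mul]
    rw [hyη, hyω] at h1
    change α y = F y * γ y at h1
    rw [h1, mul_div_cancel_right₀ _ hyne]
  have hFdC : DifferentiableAt ℂ F y₀ :=
    ((hαan.div hγan hγ0).differentiableAt).congr_of_eventuallyEq hFeq
  -- (4) conclusion
  rw [mdifferentiableAt_iff]
  refine ⟨?_, ?_⟩
  · have hev : (F ∘ φ) =ᶠ[𝓝 x₀] f := by
      filter_upwards [extChartAt_source_mem_nhds (I := 𝓘(ℝ, E)) x₀] with x hx
      simp only [hF, Function.comp_apply, φ.left_inv hx]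
    exact (hFdC.continuousAt.comp (continuousAt_extChartAt (I := 𝓘(ℝ, E)) x₀)).congr hev
  · simp only [writtenInExtChartAt, extChartAt_model_space_eq_id, PartialEquiv.refl_coe,
      CompTriple.comp_eq]
    exact hFdC.differentiableWithinAt

/-! ### Compact connected manifolds: holomorphic top forms are multiples of a nowhere-vanishing one -/

/-- **On a compact connected complex manifold with a nowhere-vanishing holomorphic `n`-form `ω₀`
(`n = dim_ℂ M`), every holomorphic `n`-form is a constant multiple of `ω₀`.** The quotient
`f = η(e)/ω₀(e)` (any complex basis `e`; `ω₀ x (e) ≠ 0` everywhere,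
`IsHolomorphicInCharts.apply_basis_ne_zero`) is holomorphic
(`mdifferentiableAt_topFormRatio_of_isHolomorphicInCharts`), hence constant on the compact
connected `M` (`MDifferentiable.exists_eq_const_of_compactSpace`), and `η = f · ω₀` pointwise
(`topForm_eq_ratio_smul`). In print: a nowhere-vanishing holomorphic section trivialises the
canonical bundle, `K_M ≅ 𝒪_M`, and `H⁰(M, 𝒪_M) = ℂ` for `M` compact connected, so
`H⁰(M, K_M) = ℂ · ω₀`. [cite: GriffithsHarris1978, Ch. 0 §2 and Ch. 1 §1]
[cite: Huybrechts2005, Prop. 2.6.11] -/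
theorem exists_eq_const_smul_of_isHolomorphicInCharts [CompactSpace M] [PreconnectedSpace M]
    [IsManifold 𝓘(ℂ, E) ω M] (hn : Module.finrank ℂ E = n) {η ω₀ : MForm 𝓘(ℝ, E) M ℂ n}
    (hη : IsHolomorphicInCharts η) (hω : IsHolomorphicInCharts ω₀) (hω0 : ∀ x, ω₀ x ≠ 0) :
    ∃ c : ℂ, η = c • ω₀ := by
  set b : Module.Basis (Fin n) ℂ E := Module.finBasisOfFinrankEq ℂ E hn with hbdef
  have hne : ∀ x, (ω₀ x : E [⋀^Fin n]→L[ℝ] ℂ) b ≠ 0 := fun x ↦ hω.apply_basis_ne_zero b (hω0 x)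
  set f : M → ℂ := fun x ↦ (η x : E [⋀^Fin n]→L[ℝ] ℂ) b / (ω₀ x : E [⋀^Fin n]→L[ℝ] ℂ) b with hf
  have hmd : MDifferentiable 𝓘(ℂ, E) 𝓘(ℂ, ℂ) f := fun x ↦
    mdifferentiableAt_topFormRatio_of_isHolomorphicInCharts hn hη hω b.linearIndependent
      (Eventually.of_forall fun y ↦ hne y)
  obtain ⟨c, hc⟩ := hmd.exists_eq_const_of_compactSpace (I := 𝓘(ℂ, E))
  refine ⟨c, funext fun x ↦ ?_⟩
  obtain ⟨a, ha⟩ := hω.exists_apply_eq_restrictScalars x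
  have key := topForm_eq_ratio_smul hη.isOfType b ha (hne x)
  have hfx : (η x : E [⋀^Fin n]→L[ℝ] ℂ) b / (ω₀ x : E [⋀^Fin n]→L[ℝ] ℂ) b = c := by
    change f x = c
    rw [hc]; rfl
  rw [hfx] at key
  rw [Pi.smul_apply]
  exact key

/-- **`Ω^n(M) = ℂ ∙ ω₀`**: on a compact connected complex `n`-manifold, the holomorphic `n`-forms
are the `ℂ`-line spanned by any nowhere-vanishing one (`exists_eq_const_smul_of_isHolomorphicInCharts`).
[cite: GriffithsHarris1978, Ch. 1 §1] [cite: Huybrechts2005, Def. 2.2.14] -/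
theorem holFormsInCharts_eq_span_singleton [CompactSpace M] [PreconnectedSpace M]
    [IsManifold 𝓘(ℂ, E) ω M] (hn : Module.finrank ℂ E = n) {ω₀ : MForm 𝓘(ℝ, E) M ℂ n}
    (hω : IsHolomorphicInCharts ω₀) (hω0 : ∀ x, ω₀ x ≠ 0) :
    holFormsInCharts E M n = ℂ ∙ ω₀ := by
  refine le_antisymm (fun η hη ↦ ?_) ?_
  · obtain ⟨c, rfl⟩ := exists_eq_const_smul_of_isHolomorphicInCharts hn hη hω hω0
    exact Submodule.smul_mem _ c (Submodule.mem_span_singleton_self ω₀)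
  · rw [Submodule.span_le, Set.singleton_subset_iff]
    exact hω

end Literature.Geometry.Kaehler

end
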